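import Mathlib
import Literature.AlgebraicGeometry.Resolution.CobordantGame
import Summits.ResolutionOfSingularities.ResolutionOfSingularities.Theorems.WeightedInvariantLocalWeightedDropGradedSliceTame

/-!
# `WeightedInvariant.LocalWeightedDrop`: the WILD SLICE, part 1 — the successor trivializes over the FROBENIUS COVER of the
# frozen coordinate (the renormalisation `Λ_q`, the cover `y_v ↦ y_v^q`, the identity)

Route `ResolutionOfSingularities/WeightedInvariant`, crux `LocalWeightedDrop` (stmt-ResolutionOfSingularities-8899).
[OURS · L1 W4.3] — graded-slice package of res-type-060 (CHAIN w43 SEAT TABLE v7; res-L1-w43-plan-1 DEALS gen 9 #11 (1) «the wild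
clause»), companion of `…GradedSliceTame` (p515424, THE TAME SLICE THEOREM) and `…GradedSliceNoOneMoveWin` (p508918, R3-T3 as typed
refuted).  Ideator res-L1-w43-idea-1 re-typed the induction vehicle as the ONE-SIDED transfer T3″ «slice graded-won by `α` ⇒ successor
graded-won by `α`», tame half = p515424, wild half = `stub_gradedWonBy_of_slice_wild` (Sketch v4 §10).  This file says what survives
of the tame mechanism at a WILD frozen coordinate `v` (= last) — `p ∣ w_v` — under the hypothesis that `v` has MINIMAL `p`-adic
valuation among the translated coordinates (`q ∣ w_v` and `q ∣ wⱼ` whenever `cⱼ ≠ 0`, `q = p^e`; without it the stub is refutable,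
res-type-099): nothing here is a statement of the manuscript under review on ladder RESOLUTION; OURS statements about the graded game;
not a verdict on card A.  AI proof, weaker than expert review.

* §0–§1 `ceilExp`/`resExp` (ceiling exponents), the renormalisation `wildLambda`
  `Λ_q = (s, ((1+y_v)^{⌈wⱼ/q⌉}(cⱼ+yⱼ) − cⱼ)ⱼ, c_v((1+y_v)^{w_v/q} − 1))`, the Frobenius cover `frobFamily` (`y_v ↦ y_v^q`),
  `wildLambdaFrob = Λ_q ∘ Frob` (`wildLambdaFrob_eq_subst`), the scalings `wildTw = ((1+y_v)s, ((1+y_v)^{q⌈wⱼ/q⌉−wⱼ} yⱼ)ⱼ, y_v)`, `wildTwR`.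
* §2 **`subst_wildLambdaFrob_eq` — THE WILD TRIVIALIZATION OVER THE FROBENIUS COVER**: from `F'(chart_c) = sᵃ·g`, in any ring with
  `(1+y_v)^q = 1 + y_v^q`, **`g(Λ_q(s, y', y_v^q)) = (1+y_v)ᵃ · ((g|_{v=0}) ⊗ 1)(Tw_q)`**; `…_charP` for `q = p^e` in characteristic `p`.
  For `q = 1` this is the tame identity `subst_tameLambda_eq`.  (res-type-099's `subst_eq_mul_subst_of_chart_factor`, p500270.)
* Part 2 (`…GradedSliceWildFrobenius`): `Λ_q` graded with `det = c_v·⌈w_v/q⌉`, T3″ ON THE FROBENIUS COVER, and the reduction of the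
  wild slice clause to one descent step.  Memo: HOME/L/res-type-060-w43/WILD-SLICE-CLAUSE.md.
-/

set_option linter.dupNamespace false -- mandated namespace of this single-conjunct summit
set_option autoImplicit false

namespace Summit.ResolutionOfSingularities.ResolutionOfSingularities.Theorems

namespace GradedGame

open MvPowerSeries
open Literature.AlgebraicGeometry.Resolution
open Literature.AlgebraicGeometry.Resolution.FormalCoordChange (linMat exists_comp_inverse)

variable {k : Type} [Field k]

/-! ## §0 Ceiling arithmetic for the exponents -/

/-- `w ≤ q·⌈w/q⌉`. [OURS · L1 W4.3] -/
theorem le_mul_ceilDiv (w q : ℕ) (hq : 0 < q) : w ≤ q * ((w + q - 1) / q) := by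
  have h1 := Nat.div_add_mod (w + q - 1) q
  have h2 := Nat.mod_lt (w + q - 1) hq
  omega

/-- `q ∣ w ⇒ q·⌈w/q⌉ = w`. [OURS · L1 W4.3] -/
theorem mul_ceilDiv_of_dvd (w q : ℕ) (hq : 0 < q) (hdvd : q ∣ w) : q * ((w + q - 1) / q) = w := by
  obtain ⟨t, rfl⟩ := hdvd
  have h : (q * t + q - 1) / q = t := by
    have h1 : q * t + q - 1 = q * t + (q - 1) := by omega
    rw [h1, Nat.mul_add_div hq, Nat.div_eq_of_lt (by omega), add_zero]
  rw [h]

/-- `q ∣ w ⇒ ⌈w/q⌉ = w/q`. [OURS · L1 W4.3] -/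
theorem ceilDiv_of_dvd (w q : ℕ) (hq : 0 < q) (hdvd : q ∣ w) : (w + q - 1) / q = w / q := by
  have h := mul_ceilDiv_of_dvd w q hq hdvd
  obtain ⟨t, rfl⟩ := hdvd
  rw [Nat.mul_div_cancel_left t hq]
  exact Nat.eq_of_mul_eq_mul_left hq (by rw [h])

/-! ## §1 The four substitution families at a wild frozen coordinate (`v` = last) -/

section Defs

variable {n : ℕ} (w : Fin (n + 1) → ℕ) (c : Fin (n + 1) → k) (q : ℕ)

/-- The ceiling exponent `⌈wⱼ/q⌉` (equal to `wⱼ/q` on the translated coordinates, where `q ∣ wⱼ`). [OURS · L1 W4.3] -/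
def ceilExp (j : Fin (n + 1)) : ℕ := (w j + q - 1) / q

/-- The compensating exponent `q·⌈wⱼ/q⌉ − wⱼ ≥ 0` (zero on the translated coordinates). [OURS · L1 W4.3] -/
def resExp (j : Fin (n + 1)) : ℕ := q * ceilExp w q j - w j

/-- THE WILD RENORMALISATION `Λ_q = (s, ((1+y_v)^{⌈wⱼ/q⌉}(cⱼ + yⱼ) − cⱼ)_{j ≠ v}, c_v((1+y_v)^{w_v/q} − 1))`: a GRADED
COORDINATE CHANGE (determinant `(w_v/q)·c_v`) at a frozen coordinate `v` = last with `q ∣ w_v` and `q ∣ wⱼ` for every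
translated `j`; for `q = 1` it is the tame trivialization `tameLambda` up to the scalings of the untranslated
coordinates. [OURS · L1 W4.3] -/
noncomputable def wildLambda : Fin (n + 1 + 1) → MvPowerSeries (Fin (n + 1 + 1)) k :=
  Fin.cases (X 0) fun j => if j = Fin.last n then C (c j) * (1 + X (Fin.last (n + 1))) ^ (ceilExp w q j) - C (c j)
    else (1 + X (Fin.last (n + 1))) ^ (ceilExp w q j) * (C (c j) + X j.succ) - C (c j)

/-- The `q`-FROBENIUS COVER of the frozen coordinate: `y_v ↦ y_v^q`, identity elsewhere. [OURS · L1 W4.3] -/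
noncomputable def frobFamily (n q : ℕ) : Fin (n + 1 + 1) → MvPowerSeries (Fin (n + 1 + 1)) k :=
  Function.update (fun i => (X i : MvPowerSeries (Fin (n + 1 + 1)) k)) (Fin.last (n + 1)) (X (Fin.last (n + 1)) ^ q)

/-- `Λ_q` followed by the Frobenius cover: `y_v ↦ y_v^q` inside `Λ_q`. [OURS · L1 W4.3] -/
noncomputable def wildLambdaFrob : Fin (n + 1 + 1) → MvPowerSeries (Fin (n + 1 + 1)) k :=
  Fin.cases (X 0) fun j => if j = Fin.last n then C (c j) * (1 + X (Fin.last (n + 1)) ^ q) ^ (ceilExp w q j) - C (c j)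
    else (1 + X (Fin.last (n + 1)) ^ q) ^ (ceilExp w q j) * (C (c j) + X j.succ) - C (c j)

/-- The diagonal scaling `Tw_q = ((1+y_v)s, ((1+y_v)^{q⌈wⱼ/q⌉ − wⱼ} yⱼ)ⱼ, y_v)` (graded, tangent to the identity).
[OURS · L1 W4.3] -/
noncomputable def wildTw : Fin (n + 1 + 1) → MvPowerSeries (Fin (n + 1 + 1)) k :=
  Fin.cases ((1 + X (Fin.last (n + 1))) * X 0) fun j => (1 + X (Fin.last (n + 1))) ^ (resExp w q j) * X j.succ

/-- `Tw_q` with the frozen slot killed (`y_v ↦ 0`): the right-hand family of the orbit computation. [OURS · L1 W4.3] -/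
noncomputable def wildTwR : Fin (n + 1 + 1) → MvPowerSeries (Fin (n + 1 + 1)) k :=
  Fin.cases ((1 + X (Fin.last (n + 1))) * X 0) fun j =>
    if j = Fin.last n then 0 else (1 + X (Fin.last (n + 1))) ^ (resExp w q j) * X j.succ

/-- `Λ_q(s) = s`. [OURS · L1 W4.3] -/
theorem wildLambda_zero : wildLambda w c q 0 = X 0 := by
  simp [wildLambda]

/-- `Λ_q(yⱼ)`. [OURS · L1 W4.3] -/
theorem wildLambda_succ (j : Fin (n + 1)) :
    wildLambda w c q j.succ = if j = Fin.last n then C (c j) * (1 + X (Fin.last (n + 1))) ^ (ceilExp w q j) - C (c j)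
      else (1 + X (Fin.last (n + 1))) ^ (ceilExp w q j) * (C (c j) + X j.succ) - C (c j) := by
  simp only [wildLambda, Fin.cases_succ]

/-- `(Λ_q ∘ Frob)(s) = s`. [OURS · L1 W4.3] -/
theorem wildLambdaFrob_zero : wildLambdaFrob w c q 0 = X 0 := by
  simp [wildLambdaFrob]

/-- `(Λ_q ∘ Frob)(yⱼ)`. [OURS · L1 W4.3] -/
theorem wildLambdaFrob_succ (j : Fin (n + 1)) :
    wildLambdaFrob w c q j.succ = if j = Fin.last n then C (c j) * (1 + X (Fin.last (n + 1)) ^ q) ^ (ceilExp w q j) - C (c j)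
      else (1 + X (Fin.last (n + 1)) ^ q) ^ (ceilExp w q j) * (C (c j) + X j.succ) - C (c j) := by
  simp only [wildLambdaFrob, Fin.cases_succ]

/-- `Tw_q(s) = (1+y_v)·s`. [OURS · L1 W4.3] -/
theorem wildTw_zero : wildTw (k := k) w q 0 = (1 + X (Fin.last (n + 1))) * X 0 := by
  simp [wildTw]

/-- `Tw_q(yⱼ) = (1+y_v)^{q⌈wⱼ/q⌉−wⱼ}·yⱼ`. [OURS · L1 W4.3] -/
theorem wildTw_succ (j : Fin (n + 1)) :
    wildTw (k := k) w q j.succ = (1 + X (Fin.last (n + 1))) ^ (resExp w q j) * X j.succ := by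
  simp only [wildTw, Fin.cases_succ]

/-- `TwR_q(s) = (1+y_v)·s`. [OURS · L1 W4.3] -/
theorem wildTwR_zero : wildTwR (k := k) w q 0 = (1 + X (Fin.last (n + 1))) * X 0 := by
  simp [wildTwR]

/-- `TwR_q(yⱼ)` (`0` at the frozen slot). [OURS · L1 W4.3] -/
theorem wildTwR_succ (j : Fin (n + 1)) :
    wildTwR (k := k) w q j.succ = if j = Fin.last n then 0 else (1 + X (Fin.last (n + 1))) ^ (resExp w q j) * X j.succ := by
  simp only [wildTwR, Fin.cases_succ]

/-- `Λ_q` has zero constant terms. [OURS · L1 W4.3] -/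
theorem constantCoeff_wildLambda (i : Fin (n + 1 + 1)) : constantCoeff (wildLambda w c q i) = 0 := by
  refine Fin.cases ?_ (fun j => ?_) i
  · rw [wildLambda_zero]; exact constantCoeff_X 0
  · rw [wildLambda_succ]
    split_ifs <;> simp [constantCoeff_X]

/-- `Λ_q ∘ Frob` has zero constant terms (`q ≥ 1`). [OURS · L1 W4.3] -/
theorem constantCoeff_wildLambdaFrob (hq : 0 < q) (i : Fin (n + 1 + 1)) : constantCoeff (wildLambdaFrob w c q i) = 0 := by
  refine Fin.cases ?_ (fun j => ?_) i
  · rw [wildLambdaFrob_zero]; exact constantCoeff_X 0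
  · rw [wildLambdaFrob_succ]
    split_ifs <;> simp [constantCoeff_X, zero_pow hq.ne']

/-- `Tw_q` has zero constant terms. [OURS · L1 W4.3] -/
theorem constantCoeff_wildTw (i : Fin (n + 1 + 1)) : constantCoeff (wildTw (k := k) w q i) = 0 := by
  refine Fin.cases ?_ (fun j => ?_) i
  · rw [wildTw_zero]; simp [constantCoeff_X]
  · rw [wildTw_succ]; simp [constantCoeff_X]

/-- `TwR_q` has zero constant terms. [OURS · L1 W4.3] -/
theorem constantCoeff_wildTwR (i : Fin (n + 1 + 1)) : constantCoeff (wildTwR (k := k) w q i) = 0 := by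
  refine Fin.cases ?_ (fun j => ?_) i
  · rw [wildTwR_zero]; simp [constantCoeff_X]
  · rw [wildTwR_succ]; split_ifs <;> simp [constantCoeff_X]

/-- `Λ_q` is substitutable. [OURS · L1 W4.3] -/
theorem hasSubst_wildLambda : HasSubst (wildLambda w c q) := hasSubst_of_constantCoeff_zero (constantCoeff_wildLambda w c q)
/-- `Λ_q ∘ Frob` is substitutable (`q ≥ 1`). [OURS · L1 W4.3] -/
theorem hasSubst_wildLambdaFrob (hq : 0 < q) : HasSubst (wildLambdaFrob w c q) :=
  hasSubst_of_constantCoeff_zero (constantCoeff_wildLambdaFrob w c q hq)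
/-- `Tw_q` is substitutable. [OURS · L1 W4.3] -/
theorem hasSubst_wildTw : HasSubst (wildTw (k := k) w q) := hasSubst_of_constantCoeff_zero (constantCoeff_wildTw w q)
/-- `TwR_q` is substitutable. [OURS · L1 W4.3] -/
theorem hasSubst_wildTwR : HasSubst (wildTwR (k := k) w q) := hasSubst_of_constantCoeff_zero (constantCoeff_wildTwR w q)

/-- The Frobenius cover is substitutable (`q ≥ 1`). [OURS · L1 W4.3] -/
theorem hasSubst_frobFamily (hq : 0 < q) : HasSubst (frobFamily (k := k) n q) :=
  hasSubst_of_constantCoeff_zero fun i => by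
    unfold frobFamily
    by_cases hi : i = Fin.last (n + 1)
    · subst hi; simp [constantCoeff_X, zero_pow hq.ne']
    · rw [Function.update_of_ne hi]; exact constantCoeff_X i

/-- `Λ_q ∘ Frob` IS `Frob` substituted into `Λ_q`. [OURS · L1 W4.3] -/
theorem wildLambdaFrob_eq_subst (hq : 0 < q) (i : Fin (n + 1 + 1)) :
    wildLambdaFrob w c q i = subst (frobFamily n q) (wildLambda w c q i) := by
  have hF := hasSubst_frobFamily (k := k) (n := n) q hq
  have h1 : subst (frobFamily (k := k) n q) (1 : MvPowerSeries (Fin (n + 1 + 1)) k) = 1 := by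
    rw [← coe_substAlgHom hF, map_one]
  have hlast : frobFamily (k := k) n q (Fin.last (n + 1)) = X (Fin.last (n + 1)) ^ q := by simp [frobFamily]
  have hother : ∀ j : Fin (n + 1), j ≠ Fin.last n → frobFamily (k := k) n q j.succ = X j.succ := by
    intro j hj
    have : j.succ ≠ Fin.last (n + 1) := by rw [← Fin.succ_last]; exact fun h => hj (Fin.succ_injective _ h)
    simp [frobFamily, this]
  refine Fin.cases ?_ (fun j => ?_) i
  · rw [wildLambdaFrob_zero, wildLambda_zero, subst_X hF]
    have : (0 : Fin (n + 1 + 1)) ≠ Fin.last (n + 1) := by rw [← Fin.succ_last]; exact (Fin.succ_ne_zero _).symm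
    simp [frobFamily, this]
  · rw [wildLambdaFrob_succ, wildLambda_succ]
    by_cases hj : j = Fin.last n
    · rw [if_pos hj, if_pos hj, subst_sub hF, subst_mul hF, subst_C, subst_pow hF, subst_add hF, h1, subst_X hF, hlast]
    · rw [if_neg hj, if_neg hj, subst_sub hF, subst_mul hF, subst_pow hF, subst_add hF, h1, subst_X hF, hlast, subst_add hF,
        subst_C, subst_X hF, hother j hj]

end Defs

/-! ## §2 The wild trivialization identity over the Frobenius cover -/

section Identity

variable {n : ℕ} (w : Fin (n + 1) → ℕ) (c : Fin (n + 1) → k) (q : ℕ)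

/-- The power identity behind the chart agreement: `(1 + y_v^q)^{⌈wⱼ/q⌉} = (1+y_v)^{wⱼ} · (1+y_v)^{q⌈wⱼ/q⌉ − wⱼ}` when
`(1 + y_v)^q = 1 + y_v^q`. [OURS · L1 W4.3] -/
theorem one_add_X_pow_pow_ceilExp (hq : 0 < q)
    (hfrob : ((1 : MvPowerSeries (Fin (n + 1 + 1)) k) + X (Fin.last (n + 1))) ^ q = 1 + X (Fin.last (n + 1)) ^ q)
    (j : Fin (n + 1)) :
    ((1 : MvPowerSeries (Fin (n + 1 + 1)) k) + X (Fin.last (n + 1)) ^ q) ^ (ceilExp w q j) =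
      (1 + X (Fin.last (n + 1))) ^ (w j) * (1 + X (Fin.last (n + 1))) ^ (resExp w q j) := by
  rw [← hfrob, ← pow_mul, ← pow_add]
  congr 1
  unfold resExp ceilExp
  have := le_mul_ceilDiv (w j) q hq
  omega

/-- On a coordinate with `q ∣ wⱼ` the compensating exponent vanishes. [OURS · L1 W4.3] -/
theorem resExp_eq_zero_of_dvd (hq : 0 < q) (j : Fin (n + 1)) (hj : q ∣ w j) : resExp w q j = 0 := by
  unfold resExp ceilExp
  rw [mul_ceilDiv_of_dvd (w j) q hq hj]
  omega

/-- THE TWO WILD FAMILIES AGREE ON THE CHART: `(chart_c)ᵢ(Λ_q ∘ Frob) = (chart_c)ᵢ(TwR_q)` — for the frozen coordinate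
`s^{w_v}(c_v + c_v((1+y_v^q)^{w_v/q} − 1)) = ((1+y_v)s)^{w_v} c_v`, for a translated `j` (`q ∣ wⱼ`)
`s^{wⱼ}(1+y_v^q)^{wⱼ/q}(cⱼ+yⱼ) = ((1+y_v)s)^{wⱼ}(cⱼ+yⱼ)`, for an untranslated `j` the compensating power of `1 + y_v`
sits in `TwR_q`. [OURS · L1 W4.3] -/
theorem subst_wildLambdaFrob_cruxChart (hq : 0 < q)
    (hfrob : ((1 : MvPowerSeries (Fin (n + 1 + 1)) k) + X (Fin.last (n + 1))) ^ q = 1 + X (Fin.last (n + 1)) ^ q)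
    (hw : 0 < w (Fin.last n)) (hv : q ∣ w (Fin.last n)) (hmin : ∀ j, j ≠ Fin.last n → c j ≠ 0 → q ∣ w j)
    (i : Fin (n + 1)) :
    subst (wildLambdaFrob w c q) (CobordantGame.cruxChart k w c i) = subst (wildTwR w q) (CobordantGame.cruxChart k w c i) := by
  have hL := hasSubst_wildLambdaFrob w c q hq
  have hR := hasSubst_wildTwR (k := k) w q
  have hpow := one_add_X_pow_pow_ceilExp (k := k) w q hq hfrob
  unfold CobordantGame.cruxChart
  by_cases h : 0 < w i
  · rw [if_pos h, subst_mul hL, subst_mul hR, subst_pow hL, subst_pow hR, subst_add hL, subst_add hR,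
      subst_C, subst_C, subst_X hL, subst_X hR, subst_X hL, subst_X hR, wildLambdaFrob_zero, wildTwR_zero,
      wildLambdaFrob_succ, wildTwR_succ, mul_pow]
    by_cases hi : i = Fin.last n
    · rw [if_pos hi, if_pos hi, hpow, resExp_eq_zero_of_dvd w q hq i (hi ▸ hv), pow_zero, mul_one]
      ring
    · rw [if_neg hi, if_neg hi, hpow]
      by_cases hc : c i = 0
      · rw [hc, map_zero]
        ring
      · rw [resExp_eq_zero_of_dvd w q hq i (hmin i hi hc), pow_zero, mul_one]
        ring
  · have hw0 : w i = 0 := by omega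
    have hi : i ≠ Fin.last n := by rintro rfl; omega
    have hE : ceilExp w q i = 0 := by
      unfold ceilExp; rw [hw0, zero_add]; exact Nat.div_eq_of_lt (by omega)
    have hr : resExp w q i = 0 := by unfold resExp; rw [hE, hw0]; simp
    rw [if_neg h, subst_X hL, subst_X hR, wildLambdaFrob_succ, wildTwR_succ, if_neg hi, if_neg hi, hE, hr, pow_zero,
      pow_zero, one_mul, one_mul]
    ring

/-- **THE WILD TRIVIALIZATION OVER THE FROBENIUS COVER.**  From `F'(chart_c) = sᵃ·g` at a frozen coordinate `v` = last
with `0 < w_v`, `q ∣ w_v` and `q ∣ wⱼ` for every translated `j ≠ v`, in any ring where `(1 + y_v)^q = 1 + y_v^q` (e.g.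
`q = p^e` in characteristic `p`): **`g(Λ_q(s, y', y_v^q)) = (1 + y_v)ᵃ · ((g|_{v=0}) ⊗ 1)(Tw_q)`** — after the graded
renormalisation `Λ_q` and the purely inseparable base change `y_v ↦ y_v^q`, the successor IS the cylinder over its slice
up to a unit and the diagonal graded scaling `Tw_q`.  For `q = 1` this is the tame trivialization (`subst_tameLambda_eq`).
[OURS · L1 W4.3] -/
theorem subst_wildLambdaFrob_eq (hq : 0 < q)
    (hfrob : ((1 : MvPowerSeries (Fin (n + 1 + 1)) k) + X (Fin.last (n + 1))) ^ q = 1 + X (Fin.last (n + 1)) ^ q)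
    (hw : 0 < w (Fin.last n)) (hv : q ∣ w (Fin.last n)) (hmin : ∀ j, j ≠ Fin.last n → c j ≠ 0 → q ∣ w j)
    (F' : MvPowerSeries (Fin (n + 1)) k) (a : ℕ) (g : MvPowerSeries (Fin (n + 1 + 1)) k)
    (hfac : subst (CobordantGame.cruxChart k w c) F' = X 0 ^ a * g) :
    subst (wildLambdaFrob w c q) g = (1 + X (Fin.last (n + 1))) ^ a * subst (wildTw w q) (cylinder (sliceGerm (Fin.last n) g)) := by
  have hL := hasSubst_wildLambdaFrob w c q hq
  have hR := hasSubst_wildTwR (k := k) w q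
  have hT := hasSubst_wildTw (k := k) w q
  have h := subst_eq_mul_subst_of_chart_factor w c hL hR (1 + X (Fin.last (n + 1)))
    (by rw [wildTwR_zero, wildLambdaFrob_zero]) (by rw [wildLambdaFrob_zero]; exact X_zero_ne_zero)
    (subst_wildLambdaFrob_cruxChart w c q hq hfrob hw hv hmin) F' a g hfac
  have hlast0 : wildTwR (k := k) w q (Fin.last (n + 1)) = 0 := by
    rw [← Fin.succ_last, wildTwR_succ, if_pos rfl]
  rw [h, subst_eq_subst_cylinder_sliceGerm (wildTwR w q) hR hlast0 g, subst_cylinder hR, subst_cylinder hT]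
  congr 1
  congr 1
  funext j
  refine Fin.cases ?_ (fun l => ?_) j
  · rw [Fin.castSucc_zero, wildTwR_zero, wildTw_zero]
  · rw [← Fin.succ_castSucc, wildTwR_succ, wildTw_succ, if_neg (Fin.castSucc_lt_last l).ne]

/-- The same identity stated in characteristic `p` with `q = p^e`. [OURS · L1 W4.3] -/
theorem subst_wildLambdaFrob_eq_charP (p : ℕ) [Fact p.Prime] [CharP k p] (e : ℕ) (hq : q = p ^ e)
    (hw : 0 < w (Fin.last n)) (hv : q ∣ w (Fin.last n)) (hmin : ∀ j, j ≠ Fin.last n → c j ≠ 0 → q ∣ w j)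
    (F' : MvPowerSeries (Fin (n + 1)) k) (a : ℕ) (g : MvPowerSeries (Fin (n + 1 + 1)) k)
    (hfac : subst (CobordantGame.cruxChart k w c) F' = X 0 ^ a * g) :
    subst (wildLambdaFrob w c q) g = (1 + X (Fin.last (n + 1))) ^ a * subst (wildTw w q) (cylinder (sliceGerm (Fin.last n) g)) := by
  haveI : CharP (MvPowerSeries (Fin (n + 1 + 1)) k) p := charP_of_injective_ringHom (C_injective) p
  have hq0 : 0 < q := by rw [hq]; exact pow_pos (Nat.Prime.pos Fact.out) e
  refine subst_wildLambdaFrob_eq w c q hq0 ?_ hw hv hmin F' a g hfac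
  rw [hq, add_pow_char_pow, one_pow]

end Identity

end GradedGame

end Summit.ResolutionOfSingularities.ResolutionOfSingularities.Theorems
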